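/-
Copyright (c) 2026 the pub-hodgecm-mathlib formalisation cell (harness21).  Prover seat hodgecm-mathlib-LH4-p08 (g4), Track A «(D-RAM) FOUR-FRAME», unit U2H, the census leaf
(ρ2b′-X) `stub_U2H_fixedPointCensus_typeTwo_unit0` — dealer LH4-plan (g12) WORD #16 hand T5a «TORIC LEVEL CENSUS» (payer LH4-p14 (g3), plan owner LH4-p12 (g4) T5-FRAME v1 §2 F1
«`{x𝒪_j} ≃ Mˣ ∕ 𝒪_jˣ`»): order lattices ↔ cosets of the order units.  2026-09-04.
-/
import Literature.NumberTheory.LocalFields.QuadraticOrderIntegralBasis   -- ★ p857021 (T4 part I: the order predicate, `one_mem_order`, `mul_mem_order`, `add_mem_order`, `neg_mem_order`, `zero_mem_order`)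
import HarnessLib

/-!
# Order lattices `x₀·(𝒪_E + c𝒪_M)` as COSETS of the order units: the unit group of the order, equality of two order lattices, and the class count
# `#{x₀𝒪_c : P(x₀)} = #(image of {P} in Mˣ ∕ 𝒪_cˣ)` (Flicker 1998 p. 84 REMARK (Mars); Serre, *Local Fields* Ch. V §1)

Topic `NumberTheory/LocalFields`; namespace `Literature.NumberTheory.LocalFields.QuadraticOrder` (= ★ T4 parts I–III p857021 ∕ p857040 ∕ p857067, ★ F3 p857156).  THEOREMS ONLY (no
definition, no instance, no notation, no named fact, no `sorry`); kernel lane `--supports stmt-HodgeConjecture-24833` (count-neutral).  Cell `pub/hodgecm-mathlib` (D-0151), crux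
H413, Track A «(D-RAM) FOUR-FRAME», unit U2H: the toric ∕ order census (ρ2b′-X) counts ORDER LATTICES `Λ = x₀·𝒪_c` (★ Mars `exists_eq_mul_order`) with a property of the generator
`x₀` that is invariant under the units of the order (integral ∕ Gram-primitive ∕ level ∕ depth are such: they read `y = h·x₀Θx₀·cδ` up to `𝒪_cˣ`); such a count is a count of
COSETS in `Mˣ ∕ 𝒪_cˣ` (LH4-p12 (g4) T5-FRAME v1 §2 organ F1 `classes_level_j`; this seat's T5a sheet (S2)∕(M7)).  THIS FILE types that dictionary once, type-blind:
* §1 THE UNITS OF THE ORDER: `x` and `x⁻¹` both lie in the order of conductor `c` iff `|x| = 1 ∧ |x − ρx| ≤ |c(α − ρα)|` (`inv_mem_order_of_v_eq_one`,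
  `mem_order_and_inv_mem_iff`); they form a subgroup of `Mˣ` — stated as EXISTENCE of a `Subgroup Mˣ` with that membership (`exists_subgroup_orderUnits`, no definition).
* §2 ORDER LATTICES: for every `x₀` the additive subgroup `x₀·𝒪_c` EXISTS (`exists_addSubgroup_mul_order`); two generators give the same lattice iff their ratio is a unit of the
  order (`mul_order_eq_iff`); membership of `x₀` itself, rescaling by units.
* §3 THE CLASS COUNT: for a subgroup `H ≤ Mˣ` with the order-unit membership and ANY property `P` of generators,
  **`#{Λ : ∃ x₀, P x₀ ∧ Λ = x₀·𝒪_c} = #(QuotientGroup.mk '' {x₀ : P x₀})`** in `Mˣ ⧸ H` (`ncard_setOf_orderLattice_eq_ncard_image_mk`) — lattices with a prescribed generator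
  property are counted by cosets; and the coset bookkeeping the census uses (§4, any commutative group): translation invariance, a coset of `B ≥ H` carries `[B : H]` classes,
  saturated differences subtract.
HONEST LABEL: HC_CM is proved only modulo the 7 printed citations (2 remaining named inputs: hLiu418 = stmt-HodgeConjecture-24832, h413 = stmt-HodgeConjecture-24833) until rung 0
closes; unconditional algebra, count-neutral (organ F1 of the (ρ2b′-X) payer plan; no census value asserted).

## References
* [Flicker1998UnitaryFL] Y. Z. Flicker, *Elementary proof of the fundamental lemma for a unitary group*, Canad. J. Math. 50 (1998): p. 84 REMARK (Mars: the lattices `z·R_E(j)`,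
  `[R_E^× : R_E(j)^×]`).
* [Serre1979] J.-P. Serre, *Local Fields*, GTM 67 (1979): Ch. V §1 (units and their filtration).
-/

set_option autoImplicit false

open WithZero
open scoped Pointwise

namespace Literature.NumberTheory.LocalFields.QuadraticOrder

variable {K : Type*} [Field K] [Valued K ℤᵐ⁰] {ρ : K →+* K} {α : K}

/-! ## §1 The units of the order of conductor `c` -/

/-- The inverse of a UNIT-VALUED element of the order lies in the order: `x⁻¹ − ρx⁻¹ = −(x − ρx)∕(x·ρx)` and `|x·ρx| = 1`. [cite: Serre1979, Ch. V §1] -/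
theorem inv_mem_order_of_v_eq_one (hvρ : ∀ x, Valued.v (ρ x) = Valued.v x) {c x : K} (hx1 : Valued.v x = 1)
    (hx : Valued.v (x - ρ x) ≤ Valued.v (c * (α - ρ α))) :
    Valued.v x⁻¹ ≤ 1 ∧ Valued.v (x⁻¹ - ρ x⁻¹) ≤ Valued.v (c * (α - ρ α)) := by
  have hx0 : x ≠ 0 := fun h => by rw [h, map_zero] at hx1; exact zero_ne_one hx1
  have hρx0 : ρ x ≠ 0 := (map_ne_zero ρ).2 hx0
  refine ⟨by rw [map_inv₀, hx1, inv_one], ?_⟩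
  have : x⁻¹ - ρ x⁻¹ = -((x - ρ x) / (x * ρ x)) := by rw [map_inv₀]; field_simp; ring
  rw [this, Valuation.map_neg, map_div₀, map_mul, hvρ, hx1, one_mul, div_one]
  exact hx

/-- **THE UNITS OF THE ORDER**: a non-zero `x` and `x⁻¹` both lie in the order of conductor `c` iff `|x| = 1` and `|x − ρx| ≤ |c(α − ρα)|`. [cite: Flicker1998UnitaryFL, p. 84] -/
theorem mem_order_and_inv_mem_iff (hvρ : ∀ x, Valued.v (ρ x) = Valued.v x) (c : K) {x : K} (hx0 : x ≠ 0) :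
    ((Valued.v x ≤ 1 ∧ Valued.v (x - ρ x) ≤ Valued.v (c * (α - ρ α))) ∧
        (Valued.v x⁻¹ ≤ 1 ∧ Valued.v (x⁻¹ - ρ x⁻¹) ≤ Valued.v (c * (α - ρ α)))) ↔
      Valued.v x = 1 ∧ Valued.v (x - ρ x) ≤ Valued.v (c * (α - ρ α)) := by
  constructor
  · rintro ⟨⟨h1, h2⟩, ⟨h3, -⟩⟩
    refine ⟨?_, h2⟩
    rw [map_inv₀] at h3
    exact le_antisymm h1 ((inv_le_one₀ (zero_lt_iff.2 ((Valuation.ne_zero_iff _).2 hx0))).1 h3)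
  · rintro ⟨h1, h2⟩
    exact ⟨⟨h1.le, h2⟩, inv_mem_order_of_v_eq_one hvρ h1 h2⟩

/-- **THE ORDER UNITS FORM A SUBGROUP OF `Mˣ`** (existence with the membership `|u| = 1 ∧ |u − ρu| ≤ |c(α − ρα)|`; no definition). [cite: Flicker1998UnitaryFL, p. 84] -/
theorem exists_subgroup_orderUnits (hvρ : ∀ x, Valued.v (ρ x) = Valued.v x) (c : K) :
    ∃ H : Subgroup Kˣ, ∀ u : Kˣ, u ∈ H ↔ Valued.v (u : K) = 1 ∧ Valued.v ((u : K) - ρ u) ≤ Valued.v (c * (α - ρ α)) := by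
  refine ⟨{ carrier := {u : Kˣ | Valued.v (u : K) = 1 ∧ Valued.v ((u : K) - ρ u) ≤ Valued.v (c * (α - ρ α))}
            mul_mem' := ?_, one_mem' := ?_, inv_mem' := ?_ }, fun u => Iff.rfl⟩
  · rintro u w ⟨hu1, hu⟩ ⟨hw1, hw⟩
    refine ⟨by rw [Units.val_mul, map_mul, hu1, hw1, one_mul], ?_⟩
    rw [Units.val_mul]
    exact (mul_mem_order hvρ ⟨hu1.le, hu⟩ ⟨hw1.le, hw⟩).2
  · exact ⟨by rw [Units.val_one, map_one], (one_mem_order (ρ := ρ) (α := α) c).2⟩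
  · rintro u ⟨hu1, hu⟩
    rw [Set.mem_setOf_eq, Units.val_inv_eq_inv_val]
    have h := inv_mem_order_of_v_eq_one hvρ hu1 hu
    exact ⟨by rw [map_inv₀, hu1, inv_one], h.2⟩

/-! ## §2 Order lattices `x₀·𝒪_c` -/

/-- **THE ORDER LATTICE `x₀·𝒪_c` EXISTS** as an additive subgroup with membership `x ∈ Λ ⟺ ∃ y ∈ 𝒪_c, x = x₀·y` (closure: ★ `zero_mem_order`, `add_mem_order`, `neg_mem_order`).
[cite: Flicker1998UnitaryFL, p. 84] -/
theorem exists_addSubgroup_mul_order (c x₀ : K) :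
    ∃ Λ : AddSubgroup K, ∀ x, x ∈ Λ ↔ ∃ y, (Valued.v y ≤ 1 ∧ Valued.v (y - ρ y) ≤ Valued.v (c * (α - ρ α))) ∧ x = x₀ * y := by
  refine ⟨{ carrier := {x | ∃ y, (Valued.v y ≤ 1 ∧ Valued.v (y - ρ y) ≤ Valued.v (c * (α - ρ α))) ∧ x = x₀ * y}
            add_mem' := ?_, zero_mem' := ?_, neg_mem' := ?_ }, fun x => Iff.rfl⟩
  · rintro a b ⟨y, hy, rfl⟩ ⟨y', hy', rfl⟩
    exact ⟨y + y', add_mem_order hy hy', by ring⟩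
  · exact ⟨0, zero_mem_order c, by ring⟩
  · rintro a ⟨y, hy, rfl⟩
    exact ⟨-y, neg_mem_order hy, by ring⟩

/-- The generator lies in its lattice (`1 ∈ 𝒪_c`). [cite: Flicker1998UnitaryFL, p. 84] -/
theorem self_mem_of_mul_order {c x₀ : K} {Λ : AddSubgroup K}
    (hΛ : ∀ x, x ∈ Λ ↔ ∃ y, (Valued.v y ≤ 1 ∧ Valued.v (y - ρ y) ≤ Valued.v (c * (α - ρ α))) ∧ x = x₀ * y) : x₀ ∈ Λ :=
  (hΛ x₀).2 ⟨1, one_mem_order c, (mul_one x₀).symm⟩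

/-- **EQUALITY OF ORDER LATTICES**: `x₀·𝒪_c = x₀′·𝒪_c` (`x₀, x₀′ ≠ 0`) iff `x₀′∕x₀` and `x₀∕x₀′` both lie in `𝒪_c` — i.e. iff the ratio is a UNIT of the order (§1).
[cite: Flicker1998UnitaryFL, p. 84] -/
theorem mul_order_eq_iff (hvρ : ∀ x, Valued.v (ρ x) = Valued.v x) {c x₀ x₀' : K} (hx₀ : x₀ ≠ 0) (hx₀' : x₀' ≠ 0) {Λ Λ' : AddSubgroup K}
    (hΛ : ∀ x, x ∈ Λ ↔ ∃ y, (Valued.v y ≤ 1 ∧ Valued.v (y - ρ y) ≤ Valued.v (c * (α - ρ α))) ∧ x = x₀ * y)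
    (hΛ' : ∀ x, x ∈ Λ' ↔ ∃ y, (Valued.v y ≤ 1 ∧ Valued.v (y - ρ y) ≤ Valued.v (c * (α - ρ α))) ∧ x = x₀' * y) :
    Λ = Λ' ↔ (Valued.v (x₀' / x₀) ≤ 1 ∧ Valued.v (x₀' / x₀ - ρ (x₀' / x₀)) ≤ Valued.v (c * (α - ρ α))) ∧
      (Valued.v (x₀ / x₀') ≤ 1 ∧ Valued.v (x₀ / x₀' - ρ (x₀ / x₀')) ≤ Valued.v (c * (α - ρ α))) := by
  constructor
  · intro h
    constructor
    · obtain ⟨y, hy, hxy⟩ := (hΛ x₀').1 (h ▸ self_mem_of_mul_order hΛ')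
      have : x₀' / x₀ = y := by rw [hxy, mul_div_cancel_left₀ _ hx₀]
      rwa [this]
    · obtain ⟨y, hy, hxy⟩ := (hΛ' x₀).1 (h ▸ self_mem_of_mul_order hΛ)
      have : x₀ / x₀' = y := by rw [hxy, mul_div_cancel_left₀ _ hx₀']
      rwa [this]
  · rintro ⟨h1, h2⟩
    ext x
    rw [hΛ, hΛ']
    constructor
    · rintro ⟨y, hy, rfl⟩
      exact ⟨x₀ / x₀' * y, mul_mem_order hvρ h2 hy, by rw [← mul_assoc, mul_div_cancel₀ _ hx₀']⟩
    · rintro ⟨y, hy, rfl⟩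
      exact ⟨x₀' / x₀ * y, mul_mem_order hvρ h1 hy, by rw [← mul_assoc, mul_div_cancel₀ _ hx₀]⟩

/-- Equality of order lattices generated by UNITS `x₀, x₀′ ∈ Mˣ`, in subgroup letters: `x₀𝒪_c = x₀′𝒪_c ⟺ x₀⁻¹x₀′ ∈ H` for any `H ≤ Mˣ` with the order-unit membership (§1).
[cite: Flicker1998UnitaryFL, p. 84] -/
theorem mul_order_eq_iff_mem (hvρ : ∀ x, Valued.v (ρ x) = Valued.v x) {c : K} {H : Subgroup Kˣ}
    (hH : ∀ u : Kˣ, u ∈ H ↔ Valued.v (u : K) = 1 ∧ Valued.v ((u : K) - ρ u) ≤ Valued.v (c * (α - ρ α)))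
    (x₀ x₀' : Kˣ) {Λ Λ' : AddSubgroup K}
    (hΛ : ∀ x, x ∈ Λ ↔ ∃ y, (Valued.v y ≤ 1 ∧ Valued.v (y - ρ y) ≤ Valued.v (c * (α - ρ α))) ∧ x = (x₀ : K) * y)
    (hΛ' : ∀ x, x ∈ Λ' ↔ ∃ y, (Valued.v y ≤ 1 ∧ Valued.v (y - ρ y) ≤ Valued.v (c * (α - ρ α))) ∧ x = (x₀' : K) * y) :
    Λ = Λ' ↔ x₀⁻¹ * x₀' ∈ H := by
  have h1 : ((x₀⁻¹ * x₀' : Kˣ) : K) = (x₀' : K) / x₀ := by rw [Units.val_mul, Units.val_inv_eq_inv_val, div_eq_mul_inv, mul_comm]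
  have hne : (x₀' : K) / x₀ ≠ 0 := div_ne_zero x₀'.ne_zero x₀.ne_zero
  rw [mul_order_eq_iff hvρ x₀.ne_zero x₀'.ne_zero hΛ hΛ', hH, h1, ← mem_order_and_inv_mem_iff hvρ c hne, inv_div]

/-! ## §3 The class count: lattices with a prescribed generator property ↔ cosets of the order units -/

/-- **THE CLASS COUNT** (organ F1): for `H ≤ Mˣ` the order units of conductor `c` and ANY property `P` of generators, the order lattices `x₀·𝒪_c` with `P x₀` are equinumerous
with the image of `{x₀ : P x₀}` in `Mˣ ⧸ H` — the map `x₀ ↦ x₀·𝒪_c` has exactly the cosets of `H` as fibres (§2).  (`Set.ncard` on both sides; no finiteness needed: both are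
images of the same set under maps with the same fibres.) [cite: Flicker1998UnitaryFL, p. 84] [cite: Serre1979, Ch. V §1] -/
theorem ncard_setOf_orderLattice_eq_ncard_image_mk (hvρ : ∀ x, Valued.v (ρ x) = Valued.v x) {c : K} {H : Subgroup Kˣ}
    (hH : ∀ u : Kˣ, u ∈ H ↔ Valued.v (u : K) = 1 ∧ Valued.v ((u : K) - ρ u) ≤ Valued.v (c * (α - ρ α))) (P : Kˣ → Prop) :
    {Λ : AddSubgroup K | ∃ x₀ : Kˣ, P x₀ ∧
        ∀ x, x ∈ Λ ↔ ∃ y, (Valued.v y ≤ 1 ∧ Valued.v (y - ρ y) ≤ Valued.v (c * (α - ρ α))) ∧ x = (x₀ : K) * y}.ncard =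
      ((QuotientGroup.mk : Kˣ → Kˣ ⧸ H) '' {x₀ | P x₀}).ncard := by
  classical
  -- the lattice of a generator, as a function (choice from §2's existence; used only inside this proof)
  have hL : ∀ x₀ : Kˣ, ∃ Λ : AddSubgroup K, ∀ x, x ∈ Λ ↔
      ∃ y, (Valued.v y ≤ 1 ∧ Valued.v (y - ρ y) ≤ Valued.v (c * (α - ρ α))) ∧ x = (x₀ : K) * y :=
    fun x₀ => exists_addSubgroup_mul_order c (x₀ : K)
  choose L hLmem using hL
  have hfib : ∀ x₀ x₀' : Kˣ, L x₀ = L x₀' ↔ (QuotientGroup.mk x₀ : Kˣ ⧸ H) = QuotientGroup.mk x₀' := by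
    intro x₀ x₀'
    rw [mul_order_eq_iff_mem hvρ hH x₀ x₀' (hLmem x₀) (hLmem x₀'), QuotientGroup.eq]
  -- both sides are images of `{P}`
  have hleft : {Λ : AddSubgroup K | ∃ x₀ : Kˣ, P x₀ ∧
        ∀ x, x ∈ Λ ↔ ∃ y, (Valued.v y ≤ 1 ∧ Valued.v (y - ρ y) ≤ Valued.v (c * (α - ρ α))) ∧ x = (x₀ : K) * y} = L '' {x₀ | P x₀} := by
    ext Λ
    simp only [Set.mem_setOf_eq, Set.mem_image]
    constructor
    · rintro ⟨x₀, hP, hΛ⟩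
      refine ⟨x₀, hP, ?_⟩
      ext x; rw [hLmem, hΛ]
    · rintro ⟨x₀, hP, rfl⟩
      exact ⟨x₀, hP, hLmem x₀⟩
  rw [hleft]
  -- a bijection between the two images
  apply Set.ncard_congr (fun Λ hΛ => QuotientGroup.mk (Classical.choose ((Set.mem_image _ _ _).1 hΛ)))
  · intro Λ hΛ
    obtain ⟨hP, -⟩ := Classical.choose_spec ((Set.mem_image _ _ _).1 hΛ)
    exact ⟨_, hP, rfl⟩
  · intro Λ Λ' hΛ hΛ' heq
    obtain ⟨-, h1⟩ := Classical.choose_spec ((Set.mem_image _ _ _).1 hΛ)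
    obtain ⟨-, h2⟩ := Classical.choose_spec ((Set.mem_image _ _ _).1 hΛ')
    rw [← h1, ← h2]
    exact (hfib _ _).2 heq
  · rintro q ⟨x₀, hP, rfl⟩
    refine ⟨L x₀, ⟨x₀, hP, rfl⟩, ?_⟩
    obtain ⟨-, h1⟩ := Classical.choose_spec ((Set.mem_image _ _ _).1 (⟨x₀, hP, rfl⟩ : L x₀ ∈ L '' {x₀ | P x₀}))
    exact (hfib _ _).1 h1

/-! ## §4 Coset bookkeeping in a commutative group (what the census's index arithmetic uses) -/

section Cosets

variable {G : Type*} [CommGroup G] (H : Subgroup G)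

/-- **TRANSLATION INVARIANCE**: `#(mk '' (g·S)) = #(mk '' S)` in `G ⧸ H`. [cite: Serre1979, Ch. V §1] -/
theorem ncard_image_mk_smul (g : G) (S : Set G) :
    ((QuotientGroup.mk : G → G ⧸ H) '' (g • S)).ncard = ((QuotientGroup.mk : G → G ⧸ H) '' S).ncard := by
  have : (QuotientGroup.mk : G → G ⧸ H) '' (g • S) = (fun q : G ⧸ H => (QuotientGroup.mk g : G ⧸ H) * q) '' ((QuotientGroup.mk : G → G ⧸ H) '' S) := by
    ext q
    simp only [Set.mem_image, Set.mem_smul_set, smul_eq_mul]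
    constructor
    · rintro ⟨x, ⟨s, hs, rfl⟩, rfl⟩
      exact ⟨QuotientGroup.mk s, ⟨s, hs, rfl⟩, (QuotientGroup.mk_mul H g s).symm⟩
    · rintro ⟨q, ⟨s, hs, rfl⟩, rfl⟩
      exact ⟨g * s, ⟨s, hs, rfl⟩, QuotientGroup.mk_mul H g s⟩
  rw [this, Set.ncard_image_of_injective _ (mul_right_injective _)]

/-- **A COSET OF `B` CARRIES `[B : H ⊓ B]` CLASSES**: `#(mk_H '' (g·B)) = H.relIndex B` (for `H ≤ B` this is `[B : H]`). [cite: Serre1979, Ch. V §1] -/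
theorem ncard_image_mk_smul_subgroup (B : Subgroup G) (g : G) :
    ((QuotientGroup.mk : G → G ⧸ H) '' (g • (B : Set G))).ncard = H.relIndex B := by
  rw [ncard_image_mk_smul, Subgroup.relIndex, Subgroup.index, ← Set.ncard_univ]
  -- `mk_H '' B ≃ B ⧸ (H ⊓ B)`: both count `B`-elements up to `H`
  classical
  symm
  apply Set.ncard_congr (fun q _ => QuotientGroup.mk ((Quotient.out q : B) : G))
  · intro q _
    exact ⟨(Quotient.out q : B), (Quotient.out q).2, rfl⟩
  · intro q q' _ _ h
    rw [QuotientGroup.eq] at h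
    rw [← Quotient.out_eq q, ← Quotient.out_eq q', QuotientGroup.eq, Subgroup.mem_subgroupOf]
    simpa using h
  · rintro x ⟨b, hb, rfl⟩
    refine ⟨QuotientGroup.mk ⟨b, hb⟩, Set.mem_univ _, ?_⟩
    have h := Quotient.out_eq (QuotientGroup.mk (s := H.subgroupOf B) (⟨b, hb⟩ : B))
    rw [QuotientGroup.eq] at h ⊢
    rw [Subgroup.mem_subgroupOf] at h
    simpa using h

/-- **SATURATED DIFFERENCES SUBTRACT**: if `A′ ⊆ A` are unions of `H`-cosets (`H`-saturated) and `mk '' A` is finite, then `#(mk '' (A ∖ A′)) = #(mk '' A) − #(mk '' A′)`.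
[cite: Serre1979, Ch. V §1] -/
theorem ncard_image_mk_diff {A A' : Set G} (hA'A : A' ⊆ A) (hsat : ∀ x ∈ A', ∀ h ∈ H, h * x ∈ A')
    (hfin : ((QuotientGroup.mk : G → G ⧸ H) '' A).Finite) :
    ((QuotientGroup.mk : G → G ⧸ H) '' (A \ A')).ncard =
      ((QuotientGroup.mk : G → G ⧸ H) '' A).ncard - ((QuotientGroup.mk : G → G ⧸ H) '' A').ncard := by
  have hdiff : (QuotientGroup.mk : G → G ⧸ H) '' (A \ A') = (QuotientGroup.mk : G → G ⧸ H) '' A \ (QuotientGroup.mk : G → G ⧸ H) '' A' := by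
    ext q
    simp only [Set.mem_image, Set.mem_sdiff]
    constructor
    · rintro ⟨x, ⟨hxA, hxA'⟩, rfl⟩
      refine ⟨⟨x, hxA, rfl⟩, ?_⟩
      rintro ⟨x', hx'A', hx'x⟩
      rw [QuotientGroup.eq] at hx'x
      have := hsat x' hx'A' _ hx'x
      rw [mul_comm, mul_inv_cancel_left] at this
      exact hxA' this
    · rintro ⟨⟨x, hxA, rfl⟩, hnot⟩
      exact ⟨x, ⟨hxA, fun hxA' => hnot ⟨x, hxA', rfl⟩⟩, rfl⟩
  rw [hdiff, Set.ncard_sdiff (Set.image_mono hA'A) (hfin.subset (Set.image_mono hA'A))]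

end Cosets

end Literature.NumberTheory.LocalFields.QuadraticOrder
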